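import Mathlib
import HarnessLib

/-!
# Route LiouvilleSarnak — support `AlignedTypeI` (stmt-ValiantsHypothesis-21040), line `characters_mod_2n`:
# the second and third ranges of Banks–Shparlinski's saving `E₂` are eventually small

Bricks for the last lemma of the chain (`H_Λ^large` of `…BilinearSieveLargeConductor.lean` from the named fact
`Literature.NumberTheory.LFunctions.BanksShparlinski2019_theorem22_twoPower_vonMangoldt`).  With `u = log x` and `L = log q`:
* `bs_range3_small` — `exp(−c u^{4/7} (log u)^{−3/7}) ≤ ε` for all `u ≥ U(c, ε)` (third range; no condition on `q`);
* `bs_range2_small` — `exp(−c (uL)^{1/2} (log L)^{−1/2}) ≤ ε` for all `L ≥ L₀(c, ε)` and `u ≥ L` (in the second range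
  `u > L^{7/3} (log L)^{5/3} ≥ L`).
The first range (which carries the factor `(log x)²` and needs `log x ≥ θ L`) is NOT treated here.

HONEST FRAMING. Pure real analysis; `AlignedTypeI` is NOT closed here; nothing bears on `VP ≠ VNP` (NOT proved).
-/

set_option linter.dupNamespace false

noncomputable section

namespace Summit.ValiantsHypothesis.ValiantsHypothesis.Theorems.LiouvilleSarnak.AlignedTypeI.CharactersModTwoN

/-- `u^{-s} ≤ (log u)^{-s}` for `u ≥ 3`, `s ≥ 0` (since `0 < log u ≤ u`). [folklore] -/
theorem rpow_neg_le_log_rpow_neg {u s : ℝ} (hu : 3 ≤ u) (hs : 0 ≤ s) :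
    u ^ (-s) ≤ Real.log u ^ (-s) := by
  have hu0 : 0 < u := by linarith
  have hlog1 : 1 ≤ Real.log u := by
    rw [← Real.log_exp 1]
    refine Real.log_le_log (Real.exp_pos 1) (le_trans ?_ hu)
    have := Real.exp_one_lt_d9
    linarith
  have hlog0 : 0 < Real.log u := by linarith
  have hle : Real.log u ≤ u := (Real.log_le_sub_one_of_pos hu0).trans (by linarith)
  rcases eq_or_lt_of_le hs with h0 | hpos
  · rw [← h0, neg_zero, Real.rpow_zero, Real.rpow_zero]
  · exact (Real.rpow_le_rpow_iff_of_neg hu0 hlog0 (by linarith)).mpr hle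

/-- **Third range.**  For `c > 0`, `ε > 0` there is `U` such that `exp(−(c · u^{4/7} · (log u)^{−3/7})) ≤ ε` for all `u ≥ U`
(`u = log x` in Banks–Shparlinski 2019 Thm 2.2). [folklore] -/
theorem bs_range3_small {c ε : ℝ} (hc : 0 < c) (hε : 0 < ε) :
    ∃ U : ℝ, ∀ u : ℝ, U ≤ u →
      Real.exp (-(c * u ^ (4 / 7 : ℝ) * Real.log u ^ (-(3 / 7 : ℝ)))) ≤ ε := by
  -- threshold: `u ≥ 3` and `u ≥ M^7` with `M = max 0 (-log ε) / c`
  set M : ℝ := max 0 (-Real.log ε) / c with hM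
  have hM0 : 0 ≤ M := by positivity
  refine ⟨max 3 (M ^ 7), fun u hu => ?_⟩
  have hu3 : 3 ≤ u := le_trans (le_max_left _ _) hu
  have huM : M ^ 7 ≤ u := le_trans (le_max_right _ _) hu
  have hu0 : 0 < u := by linarith
  -- `u^{4/7} (log u)^{-3/7} ≥ u^{4/7} u^{-3/7} = u^{1/7} ≥ M`
  have h1 : u ^ (4 / 7 : ℝ) * u ^ (-(3 / 7 : ℝ)) ≤ u ^ (4 / 7 : ℝ) * Real.log u ^ (-(3 / 7 : ℝ)) :=
    mul_le_mul_of_nonneg_left (rpow_neg_le_log_rpow_neg hu3 (by norm_num)) (Real.rpow_nonneg hu0.le _)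
  have h2 : u ^ (4 / 7 : ℝ) * u ^ (-(3 / 7 : ℝ)) = u ^ (1 / 7 : ℝ) := by
    rw [← Real.rpow_add hu0]
    norm_num
  have h3 : M ≤ u ^ (1 / 7 : ℝ) := by
    have h4 : (M ^ 7) ^ (1 / 7 : ℝ) ≤ u ^ (1 / 7 : ℝ) := Real.rpow_le_rpow (by positivity) huM (by norm_num)
    have h5 : (M ^ 7) ^ (1 / 7 : ℝ) = M := by
      rw [show (1 / 7 : ℝ) = ((7 : ℕ) : ℝ)⁻¹ by norm_num]
      exact Real.pow_rpow_inv_natCast hM0 (by norm_num)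
    rw [h5] at h4
    exact h4
  have hexp : c * u ^ (4 / 7 : ℝ) * Real.log u ^ (-(3 / 7 : ℝ)) ≥ c * M := by
    have : c * (u ^ (4 / 7 : ℝ) * Real.log u ^ (-(3 / 7 : ℝ))) ≥ c * M :=
      mul_le_mul_of_nonneg_left (h3.trans (h2 ▸ h1)) hc.le
    linarith
  have hcM : -Real.log ε ≤ c * M := by
    rw [hM, mul_div_cancel₀ _ hc.ne']
    exact le_max_right _ _
  calc Real.exp (-(c * u ^ (4 / 7 : ℝ) * Real.log u ^ (-(3 / 7 : ℝ)))) ≤ Real.exp (Real.log ε) :=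
        Real.exp_le_exp.mpr (by linarith)
    _ = ε := Real.exp_log hε

/-- **Second range.**  For `c > 0`, `ε > 0` there is `L₀` such that `exp(−(c · (u·L)^{1/2} · (log L)^{−1/2})) ≤ ε` for all
`L ≥ L₀` and `u ≥ L` (`u = log x`, `L = log q`; in the second range of Banks–Shparlinski 2019 Thm 2.2 one has
`u > L^{7/3} (log L)^{5/3} ≥ L`). [folklore] -/
theorem bs_range2_small {c ε : ℝ} (hc : 0 < c) (hε : 0 < ε) :
    ∃ L₀ : ℝ, ∀ L : ℝ, L₀ ≤ L → ∀ u : ℝ, L ≤ u →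
      Real.exp (-(c * (u * L) ^ (1 / 2 : ℝ) * Real.log L ^ (-(1 / 2 : ℝ)))) ≤ ε := by
  set M : ℝ := max 0 (-Real.log ε) / c with hM
  have hM0 : 0 ≤ M := by positivity
  refine ⟨max 3 (M ^ 2), fun L hL u hu => ?_⟩
  have hL3 : 3 ≤ L := le_trans (le_max_left _ _) hL
  have hLM : M ^ 2 ≤ L := le_trans (le_max_right _ _) hL
  have hL0 : 0 < L := by linarith
  have hu0 : 0 ≤ u := by linarith
  -- `(uL)^{1/2} ≥ (L·L)^{1/2} = L` and `(log L)^{-1/2} ≥ L^{-1/2}`; product `≥ L^{1/2} ≥ M`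
  have h1 : L ≤ (u * L) ^ (1 / 2 : ℝ) := by
    have h : (L * L) ^ (1 / 2 : ℝ) ≤ (u * L) ^ (1 / 2 : ℝ) :=
      Real.rpow_le_rpow (by positivity) (mul_le_mul_of_nonneg_right hu hL0.le) (by norm_num)
    have h' : (L * L) ^ (1 / 2 : ℝ) = L := by
      rw [← sq, show (1 / 2 : ℝ) = ((2 : ℕ) : ℝ)⁻¹ by norm_num]
      exact Real.pow_rpow_inv_natCast hL0.le (by norm_num)
    rw [h'] at h
    exact h
  have h2 : L ^ (-(1 / 2 : ℝ)) ≤ Real.log L ^ (-(1 / 2 : ℝ)) := rpow_neg_le_log_rpow_neg hL3 (by norm_num)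
  have h3 : L * L ^ (-(1 / 2 : ℝ)) = L ^ (1 / 2 : ℝ) := by
    conv_lhs => rw [show L = L ^ (1 : ℝ) by rw [Real.rpow_one], ← Real.rpow_mul hL0.le]
    rw [← Real.rpow_add hL0]
    norm_num
  have h4 : M ≤ L ^ (1 / 2 : ℝ) := by
    have h : (M ^ 2) ^ (1 / 2 : ℝ) ≤ L ^ (1 / 2 : ℝ) := Real.rpow_le_rpow (by positivity) hLM (by norm_num)
    have h' : (M ^ 2) ^ (1 / 2 : ℝ) = M := by
      rw [show (1 / 2 : ℝ) = ((2 : ℕ) : ℝ)⁻¹ by norm_num]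
      exact Real.pow_rpow_inv_natCast hM0 (by norm_num)
    rw [h'] at h
    exact h
  have hprod : M ≤ (u * L) ^ (1 / 2 : ℝ) * Real.log L ^ (-(1 / 2 : ℝ)) := by
    calc M ≤ L ^ (1 / 2 : ℝ) := h4
      _ = L * L ^ (-(1 / 2 : ℝ)) := h3.symm
      _ ≤ (u * L) ^ (1 / 2 : ℝ) * Real.log L ^ (-(1 / 2 : ℝ)) :=
          mul_le_mul h1 h2 (Real.rpow_nonneg hL0.le _) (Real.rpow_nonneg (by positivity) _)
  have hexp : c * M ≤ c * (u * L) ^ (1 / 2 : ℝ) * Real.log L ^ (-(1 / 2 : ℝ)) := by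
    have := mul_le_mul_of_nonneg_left hprod hc.le
    linarith [this]
  have hcM : -Real.log ε ≤ c * M := by
    rw [hM, mul_div_cancel₀ _ hc.ne']
    exact le_max_right _ _
  calc Real.exp (-(c * (u * L) ^ (1 / 2 : ℝ) * Real.log L ^ (-(1 / 2 : ℝ)))) ≤ Real.exp (Real.log ε) :=
        Real.exp_le_exp.mpr (by linarith)
    _ = ε := Real.exp_log hε

end Summit.ValiantsHypothesis.ValiantsHypothesis.Theorems.LiouvilleSarnak.AlignedTypeI.CharactersModTwoN
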